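import Summits.PneNP.PneNP.Theses.RootDecompSpaceCeiling
import Literature.Computability.Complexity.Counting
import Literature.Computability.Complexity.CountingProofs
import Literature.Computability.Complexity.OracleEmptyFP
import Literature.Computability.Complexity.Oracle
import Literature.Computability.Complexity.OracleProofs

/-! # Root decomposition N3 (SpaceCeiling) — glue of the cycle-2 split of `CollapseLift`

Closes the support/glue item stmt-PneNP-32399 `CensusSplitGlue` of route
`route-PneNP-RootDecompSpaceCeiling` (cycle-2 node of the decomp-pnenp cell; writer g6 rev 7):
`CensusLiftSqrt → CensusAmplifySqrt → CollapseLift`.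

Port of lens-3 g10 `collapseLift_of_split` / writer certificate `N3C2_items-g6.lean`
(`censusSplitGlue_holds`): the two children give `#P ⊆ FP` under `NP ⊆ P`; then `PP ⊆ P^{#P}`
(tree `PP_subset_PSharpP_holds`) and a polynomial-time function oracle gives no power
(tree `PRel_subset_P_of_mem_FP`). Hypothesis-free; standard axioms only.
-/

namespace Summit.PneNP.PneNP.Theorems

open Literature.Computability.Complexity

/-- `#P ⊆ FP ⟹ PP ⊆ P`: `PP ⊆ P^{#P}` and an `FP` oracle adds nothing to `P`. -/
private theorem PP_subset_P_of_sharpP_easy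
    (h : ∀ f ∈ SharpP, (Computability.encodeNat ∘ f) ∈ FP) : PP ⊆ Classes.P := by
  intro L hL
  have hPPS : PP ⊆ PSharpP := PP_subset_PSharpP_holds
  obtain ⟨f, hf, hLf⟩ := Set.mem_iUnion₂.1 (hPPS hL)
  exact PRel_subset_P_of_mem_FP (h := Oracle.ofFun f) (h f hf) hLf

/-- GLUE of the cycle-2 split of the hub residual `K = CollapseLift` (stmt-PneNP-23703) along the
census-description dial at budget `√m`: the children `CensusLiftSqrt` (stmt-PneNP-32397) and
`CensusAmplifySqrt` (stmt-PneNP-32398) imply the parent. Closes stmt-PneNP-32399. -/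
theorem censusSplitGlue_proof :
    Summit.PneNP.PneNP.Theses.RootDecompSpaceCeiling.CensusSplitGlue := by
  unfold Summit.PneNP.PneNP.Theses.RootDecompSpaceCeiling.CensusSplitGlue
    Summit.PneNP.PneNP.Theses.RootDecompSpaceCeiling.CensusAmplifySqrt
    Summit.PneNP.PneNP.Theses.RootDecompSpaceCeiling.CollapseLift
  intro hD hT hNP
  exact PP_subset_P_of_sharpP_easy (hT hD hNP)

end Summit.PneNP.PneNP.Theorems
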